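import Summits.Ventures.PercRepro.ProfileGapMonoThresholdHard

/-!
# PercRepro — THE THRESHOLD FAMILY AT CO-RANK TWO IS A THEOREM (p5, gen 24; `proofs/P5-GM1.md` §22; announced
INBOX 11972)

On a SIMPLE matroid (no loop, no parallel pair) every rank-`1` set is a singleton `{b}`, so the threshold demand
at co-rank `2` is `Σ_{b : ρ(E∖b) ≥ t+1} ρ(E∖b) ≤ #L_t · (n − 1)`, and for every such `b` and every `y ≠ b` the pair
`{b, y}` has rank `2` and co-rank `≥ ρ(E∖b) − 1 ≥ t`: the map `(b, y) ↦ {b, y}` of the `#L_t · (n − 1)` pairs into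
`T_t` is at most two-to-one, whence `(I_t)` at co-rank `2` for every `t`.  Loops and parallel points reduce by the
kernel lemmas of the family (`thresholdIneq_of_loop`, `delMonoT_of_parallel` with the co-rank-`1` input
`thresholdIneq_one`), so `(I_t)` holds at co-rank `2` on EVERY finite matroid for every `t ≥ 1` — unconditionally.
Consequences: `(★_2)` at `u = 3`, i.e. `(GM)_2` at every coloop at the level `3`; and the assembly of
`ProfileGapMonoThresholdHard` at co-rank `3` rests on the rule `HardRuleT α 3 t'` (`3 ≤ t'`) ALONE.

* `eq_singleton_of_mem_Rq_one`, **`thresholdIneq_two_of_simple`**, `thresholdIneq_two_aux`, **`thresholdIneq_two`**,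
  **`starQ_two_three`**, **`gapMonoQ_coloop_two_three`**, **`thresholdIneq_three_of_hardRuleT`**,
  **`starQ_three_four_of_hardRuleT'`**.
-/

open scoped Matroid

namespace PercRepro.Cogirth

open Finset ThmH Skew Shadow Profile

variable {α : Type} [DecidableEq α] {M : Matroid α} [M.Finite]

section ThresholdTwo

variable {N : Matroid α} [N.Finite]

/-- In a matroid without loops and without parallel pairs, every rank-`1` set is a singleton. -/
theorem eq_singleton_of_mem_Rq_one (hloop : ∀ x ∈ gr N, rk N {x} = 1)
    (hpar : ∀ x ∈ gr N, ∀ y ∈ gr N, x ≠ y → rk N {x, y} ≠ 1) {B : Finset α} (hB : B ∈ Rq N 1) :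
    ∃ b ∈ gr N, B = {b} := by
  rw [mem_Rq] at hB
  have h1 : rk N B = 1 := rk_eq_of_eRk_eq_cq hB.2
  obtain ⟨b, hb⟩ : B.Nonempty := by
    rw [nonempty_iff_ne_empty]
    rintro rfl
    have := rk_le_card (M := N) (∅ : Finset α)
    rw [card_empty] at this
    omega
  refine ⟨b, hB.1 hb, ?_⟩
  ext x
  constructor
  · intro hx
    by_contra hxb
    rw [mem_singleton] at hxb
    have hsub : ({x, b} : Finset α) ⊆ B := by
      intro y hy
      rw [mem_insert, mem_singleton] at hy
      rcases hy with rfl | rfl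
      · exact hx
      · exact hb
    have hle := rk_mono' (M := N) hsub
    have hge := rk_mono' (M := N) (show ({b} : Finset α) ⊆ {x, b} by simp)
    rw [hloop b (hB.1 hb)] at hge
    exact hpar x (hB.1 hx) b (hB.1 hb) hxb (by omega)
  · intro hx
    rw [mem_singleton] at hx
    subst hx
    exact hb

/-- **`(I_t)` at co-rank `2` on every simple matroid, for every `t`**: the demand is `≤ #L_t · (n − 1)` and the
pairs `(b, y)`, `b ∈ L_t`, `y ≠ b`, map at most two-to-one onto rank-`2` sets of co-rank `≥ t`. -/
theorem thresholdIneq_two_of_simple (hloop : ∀ x ∈ gr N, rk N {x} = 1)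
    (hpar : ∀ x ∈ gr N, ∀ y ∈ gr N, x ≠ y → rk N {x, y} ≠ 1) (t : ℕ) : ThresholdIneq N 2 t := by
  unfold ThresholdIneq thresholdSum
  -- `L`: the rank-`1` sets with complement rank `≥ t + 1`
  set L := (Rq N (2 - 1)).filter (fun B => t + 1 ≤ rk N (gr N \ B)) with hL
  -- the pairs `(B, y)` with `B ∈ L`, `y ∈ E ∖ B`
  set P := L.sigma (fun B => gr N \ B) with hP
  -- step 1: the demand is at most the number of pairs
  have h1 : ∑ B ∈ Rq N (2 - 1), (if t + 1 ≤ rk N (gr N \ B) then rk N (gr N \ B) else 0) ≤ P.card := by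
    rw [hP, card_sigma, hL, sum_filter]
    apply sum_le_sum
    intro B _
    split_ifs
    · exact rk_le_card _
    · exact Nat.zero_le _
  -- step 2: the pairs map at most two-to-one into `levelSetCoQ N t 2`
  have h2 : P.card ≤ 2 * (levelSetCoQ N t 2).card := by
    apply card_le_mul_card_image_of_maps_to (f := fun p : (Σ _ : Finset α, α) => insert p.2 p.1)
    · -- maps to
      rintro ⟨B, y⟩ hp
      rw [hP, mem_sigma] at hp
      obtain ⟨hBL, hy⟩ := hp
      rw [hL, mem_filter] at hBL
      obtain ⟨hB, hBt⟩ := hBL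
      obtain ⟨b, hb, rfl⟩ := eq_singleton_of_mem_Rq_one hloop hpar hB
      rw [mem_sdiff, mem_singleton] at hy
      obtain ⟨hyg, hyb⟩ := hy
      rw [mem_levelSetCoQ]
      refine ⟨⟨insert_subset hyg (singleton_subset_iff.2 hb), ?_⟩, ?_⟩
      · -- rank `2`
        apply eRk_eq_of_rk_eq_cq
        have hne : rk N {y, b} ≠ 1 := hpar y hyg b hb hyb
        have hle : rk N {y, b} ≤ 2 := by
          have h := rk_le_card (M := N) ({y, b} : Finset α)
          have hc : ({y, b} : Finset α).card ≤ 2 := card_le_two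
          omega
        have hge : 1 ≤ rk N {y, b} := by
          have h := rk_mono' (M := N) (show ({b} : Finset α) ⊆ {y, b} by simp)
          rw [hloop b hb] at h
          exact h
        show rk N {y, b} = 2
        omega
      · -- co-rank `≥ t`
        have hsd : gr N \ insert y {b} = (gr N \ {b}).erase y := by
          ext x
          simp only [mem_sdiff, mem_insert, mem_singleton, mem_erase, not_or]
          tauto
        have hyB : y ∈ gr N \ {b} := mem_sdiff.2 ⟨hyg, by rwa [mem_singleton]⟩
        have h3 : rk N (gr N \ {b}) ≤ rk N ((gr N \ {b}).erase y) + 1 := by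
          have h := rk_insert_eq hyg (X := (gr N \ {b}).erase y) ((erase_subset _ _).trans sdiff_subset)
          rw [insert_erase hyB] at h
          split_ifs at h <;> omega
        simp only at hBt
        rw [hsd]
        omega
    · -- every fibre has at most two elements
      intro S _
      rcases (P.filter (fun p : (Σ _ : Finset α, α) => insert p.2 p.1 = S)).eq_empty_or_nonempty with
        hemp | ⟨⟨B₀, y₀⟩, hp₀⟩
      · rw [hemp, card_empty]
        exact Nat.zero_le _
      · -- `S = insert y₀ B₀` with `B₀` a singleton: `S` has at most two elements, and the fibre injects into `S`
        rw [mem_filter] at hp₀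
        obtain ⟨hp₀, hS₀⟩ := hp₀
        rw [hP, mem_sigma] at hp₀
        rw [hL, mem_filter] at hp₀
        obtain ⟨b₀, _, rfl⟩ := eq_singleton_of_mem_Rq_one hloop hpar hp₀.1.1
        have hScard : S.card ≤ 2 := by
          simp only at hS₀
          rw [← hS₀]
          have h := card_insert_le y₀ ({b₀} : Finset α)
          rw [card_singleton] at h
          exact h
        refine le_trans (card_le_card_of_injOn (fun p : (Σ _ : Finset α, α) => p.2) ?_ ?_) hScard
        · -- maps to `S`
          intro p hp
          rw [mem_coe, mem_filter] at hp
          rw [mem_coe, ← hp.2]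
          exact mem_insert_self _ _
        · -- injective: `p.1 = S.erase p.2`
          rintro ⟨B₁, y₁⟩ hp₁ ⟨B₂, y₂⟩ hp₂ heq
          simp only at heq
          subst heq
          rw [mem_coe, mem_filter, hP, mem_sigma] at hp₁ hp₂
          have hy₁ : y₁ ∉ B₁ := fun h => (mem_sdiff.1 hp₁.1.2).2 h
          have hy₂ : y₁ ∉ B₂ := fun h => (mem_sdiff.1 hp₂.1.2).2 h
          have hB : B₁ = B₂ := by
            have e₁ : B₁ = (insert y₁ B₁).erase y₁ := (erase_insert hy₁).symm
            have e₂ : B₂ = (insert y₁ B₂).erase y₁ := (erase_insert hy₂).symm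
            simp only at hp₁ hp₂
            rw [e₁, e₂, hp₁.2, hp₂.2]
          subst hB
          rfl
  exact le_trans h1 h2

/-- The inner induction on `#E` at co-rank `2`: loops and parallel points reduce, simple matroids are direct. -/
theorem thresholdIneq_two_aux (n : ℕ) :
    ∀ (N : Matroid α) [N.Finite], (gr N).card = n → ∀ t, 1 ≤ t → ThresholdIneq N 2 t := by
  induction n using Nat.strong_induction_on with
  | _ n ih =>
  intro N _ hN t ht
  have ihdel : ∀ z ∈ gr N, ThresholdIneq (N ＼ ({z} : Set α)) 2 t := by
    intro z hz
    have hlt : ((gr N).erase z).card < n := by rw [← hN]; exact card_erase_lt_of_mem hz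
    exact ih _ hlt (N ＼ ({z} : Set α)) (by rw [gr_delete']) t ht
  -- a loop
  by_cases hloop : ∃ ℓ ∈ gr N, rk N {ℓ} = 0
  · obtain ⟨ℓ, hℓ, h0⟩ := hloop
    exact thresholdIneq_of_loop hℓ h0 (ihdel ℓ hℓ)
  have hloop' : ∀ x ∈ gr N, rk N {x} = 1 := by
    intro x hx
    have h2 : rk N {x} ≠ 0 := fun h => hloop ⟨x, hx, h⟩
    have h3 : rk N {x} ≤ 1 := by
      have := rk_le_card (M := N) ({x} : Finset α)
      simpa using this
    omega
  -- a parallel pair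
  by_cases hpar : ∃ z ∈ gr N, ∃ z' ∈ gr N, z ≠ z' ∧ rk N {z, z'} = 1
  · obtain ⟨z, hz, z', hz', hzz', hpar⟩ := hpar
    have hprev : ThresholdIneq ((N ＼ ({z} : Set α)) ／ ({z'} : Set α)) (2 - 1) (t - 1) :=
      thresholdIneq_one _ (t - 1)
    have hdm := delMonoT_of_parallel hz hz' hzz' (hloop' z hz) (hloop' z' hz') hpar (le_refl 2)
      (by omega) hprev
    exact thresholdIneq_of_delMonoT hdm (ihdel z hz)
  -- simple
  exact thresholdIneq_two_of_simple hloop' (fun x hx y hy hxy h => hpar ⟨x, hx, y, hy, hxy, h⟩) t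

/-- **THE THRESHOLD FAMILY AT CO-RANK TWO, UNCONDITIONALLY**: `(I_t)` holds at `q = 2` on every finite matroid for
every threshold `t ≥ 1` (`t = 0` is the offset `−2`, outside the family's range). -/
theorem thresholdIneq_two (N : Matroid α) [N.Finite] {t : ℕ} (ht : 1 ≤ t) : ThresholdIneq N 2 t :=
  thresholdIneq_two_aux _ N rfl t ht

/-- **`(★_2)` at the level `u = 3`, unconditionally.** -/
theorem starQ_two_three {z : α} : StarQ M z 2 3 :=
  (starQ_succ_iff_thresholdIneq (by norm_num)).2 (thresholdIneq_two _ (by norm_num))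

/-- **`(GM)_2` at every coloop at the level `u = 3`, unconditionally**: the row `(2, 2)` of `M ∖ z` is trivial and
`(★_2)` at `u = 3` is a theorem. -/
theorem gapMonoQ_coloop_two_three {z : α} (hz : z ∈ gr M) (hzc : rk M ((gr M).erase z) + 1 = rk M (gr M)) :
    GapMonoQ M z 2 3 := by
  have hrow : ProfileIneqMinusQ (M ＼ ({z} : Set α)) 2 (2 + 1 - 1) := by
    rw [Nat.add_sub_cancel]
    exact profileIneqMinusQ_self _ 2
  exact gapMonoQ_of_coloop_of_starQ hz hzc (by norm_num) (by norm_num) hrow starQ_two_three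

/-- **`(I_t)` at co-rank `3` from the rule on the hard class at co-rank `3` alone** (the row `(2, 3)` is a tree
theorem and co-rank `2` is `thresholdIneq_two`). -/
theorem thresholdIneq_three_of_hardRuleT (hrule : ∀ t', 3 ≤ t' → HardRuleT α 3 t')
    (N : Matroid α) [N.Finite] {t : ℕ} (h3t : 3 ≤ t) : ThresholdIneq N 3 t := by
  have hprev : ∀ (K : Matroid α) [K.Finite] (t' : ℕ), 3 - 1 ≤ t' → ThresholdIneq K (3 - 1) t' := by
    intro K _ t' ht'
    exact thresholdIneq_two K (by omega)
  have hrow : ∀ (K : Matroid α) [K.Finite], ThresholdIneq K 3 (3 - 1) := fun K _ =>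
    thresholdIneq_row_of_le_three K (by norm_num) (by norm_num)
  exact thresholdIneq_of_hardRuleT_aux (by norm_num) hprev hrow hrule _ N rfl t h3t

/-- **The first hard instance of the coloop band case, `(★_3)` at `u = 4`, from the rule on the hard class at
co-rank `3` alone.** -/
theorem starQ_three_four_of_hardRuleT' {z : α} (hrule : ∀ t', 3 ≤ t' → HardRuleT α 3 t') : StarQ M z 3 4 :=
  (starQ_succ_iff_thresholdIneq (by norm_num)).2 (thresholdIneq_three_of_hardRuleT hrule _ (by norm_num))

end ThresholdTwo

end PercRepro.Cogirth
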